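import Summits.BirchSwinnertonDyer.BirchSwinnertonDyer.Theorems.PrintCf2SplitBadTwoFrameSupplyV10OfQuadraticPart
import Literature.NumberTheory.EllipticCurves.Agboola2007.RestrictedSelmerGroups
import Literature.NumberTheory.EllipticCurves.ZpExtensionSplitLineProofs
import Literature.NumberTheory.EllipticCurves.BSDSelmerParityDokchitserTowerProofs
import HarnessLib

/-!
# Crux `PrintCf2.SplitBadTwoRankOneOfFacts` (stmt-BirchSwinnertonDyer-20368), road α — S1-v10a: the v10 FRAME SUPPLY with an ADAPTED generator pair
# (`κ₂` = THE `ℤ₂`-line unramified outside `v̄`)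

Cell `bsd-print-cf2`, LEAD seat `bsd-line-cf2-p1` g13 (prover-bsd-line-cf2-p1-g13-0); `--supports stmt-BirchSwinnertonDyer-20368` (helper, Theses-free).
HONEST FRAMING: a STRENGTHENING of the landed supply theorem `RubinValueTwoV10.frameSupply_two_v10_of_quadraticPart` (p655731, LEAD g11) by ONE
conjunct — the second coordinate `κ₂` of the supplied generator pair of the `ℤ₂²`-tower IS Agboola's line `K*_∞` (`κ₂.IsUnramifiedOutside vbar`),
so that `γ₁ ∈ ker κ₂` topologically generates `Gal(K̃_∞/K*_∞)` and the descent from the two-variable algebra `Λ₂ = Λ⟦T₁⟧` to `Λ(K*_∞)` is the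
quotient by the OUTER variable `T₁` (the tree's `PowerSeriesSpecialization.charIdeal_quotSMulTop_eq_mul` / `QuotSMulTop PowerSeries.X`). This is
what lets skeleton v10.4 state the laws S2′/S3b′ for ADAPTED pairs only (weaker stubs) and removes the change-of-generator-pair covariance from
S3b′'s proof obligations (S3B-TWIST-RECIPE-w5g2 §3 (b), rated L). Nothing here closes a stub; BSD is not proved by any of this; no summit statement
is proved by this seat. No definition, no named fact beyond the two antecedents already carried by v10.3 (`rank_eq_analyticRank_of_analyticRank_le_one`,
`Deuring_exists_heckeCharacter_of_maximalCM`), no `sorry`.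

PROOF: verbatim the proof of p655731 with step (c) «a generator pair» replaced by: the line `κ` unramified outside `v̄` EXISTS (-w6 g3's discharge
`ZpExtension.existsUnique_isUnramifiedOutside_of_split_holds`, read through `…of_split.exists_isUnramifiedOutside_bar`), has a topological generator
(`ZpExtension.exists_isTopGenerator`), is half of a generator pair at `p = 2` (-w4 g7 `GeneratorPairSupply.exists_isTopGeneratorPair_of_isTopGenerator_two`),
and `IsTopGeneratorPair` is symmetric, so the line can be taken as the SECOND coordinate.
presearch: not applicable (assembly of tree theorems). beyond-print theorem: no.

References: [deShalit1987] II.4.17 (54); [Washington1997] §7.2, §13.1, Thm. 13.4; [Rubin1991] §4 p. 36; [Agboola2007] §1 p. 1.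
-/

set_option autoImplicit false
set_option linter.dupNamespace false

noncomputable section

open scoped Classical
open NumberField IsDedekindDomain Field WeierstrassCurve
open Literature.NumberTheory.GaloisRepresentations Literature.NumberTheory.EllipticCurves
open Literature.NumberTheory.EllipticCurves.Rank1Residual
open Literature.NumberTheory.EllipticCurves.DeShalit1987

namespace Summit.BirchSwinnertonDyer.BirchSwinnertonDyer.Theorems.PrintCf2.RubinValueTwoV10

/-- **S1-v10a — the v10 frame supply with an ADAPTED pair** (`κ₂.IsUnramifiedOutside vbar` added to the conclusion of
`frameSupply_two_v10_of_quadraticPart`, everything else VERBATIM; same hypotheses `hQ`, GZK, Deuring).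
[cite: deShalit1987, II.4.17 (54)] [cite: Washington1997, §13.1 and Thm. 13.4] [cite: Agboola2007, §1 p. 1] -/
theorem frameSupply_two_v10a_of_quadraticPart
    (hQ : ∀ (d : ℤ), d ≠ 0 → ∀ (W : WeierstrassCurve ℚ) [W.IsElliptic] [W.IsGloballyMinimal] (C : VariableChange ℚ),
      C • W = cm7.quadraticTwist (d : ℚ) →
      ∀ (K : Type) [Field K] [NumberField K], IsImaginaryQuadratic K →
      ∀ (v vbar : HeightOneSpectrum (𝓞 K)),
        ((2 : ℕ) : 𝓞 K) ∈ v.asIdeal → ((2 : ℕ) : 𝓞 K) ∈ vbar.asIdeal → vbar ≠ v →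
      ∀ (ι : PadicAlgCl 2 ≃+* ℂ),
        (∀ (w : InfinitePlace K) (k : 𝓞 K), k ∈ v.asIdeal ↔ ‖ι.symm (w.embedding (k : K))‖ < 1) →
      ∀ (c : K ≃ₐ[ℚ] K), c ≠ 1 →
      ∀ (ψ : HeckeCharacter K), ψ.HasInfinityType (fun _ ↦ 1) (fun _ ↦ 0) → IsHeckeConjEquivariant c ψ →
        (∀ s : ℂ, 3 / 2 < s.re → heckeLFunction ψ s = W.LSeries s) →
      ∀ (κ₁ κ₂ : ZpExtension K 2) (γ₁ γ₂ : absoluteGaloisGroup K), ZpExtension.IsTopGeneratorPair κ₁ κ₂ γ₁ γ₂ →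
      ∃ (θ : FramedGaloisRep K (padicCoeffIntegers (∅ : Set (PadicAlgCl 2))) 1)
        (θK ρ : HeckeCharacter K) (r : FramedGaloisRep K (PadicAlgCl 2) 1) (Sθ : Finset (HeightOneSpectrum (𝓞 K))),
        (∀ σ : absoluteGaloisGroup K, θ σ ^ 2 = 1) ∧ KellerYin2024.IsHeckeCharOf ι θ θK ∧ θK * θK = 1 ∧
        IsPAdicAvatarOf ι ρ r ∧ FactorsThroughPair κ₁ κ₂ r ∧ θK⁻¹ * ρ = (HeckeCharacter.galConj c ψ)⁻¹ ∧
        v ∉ Sθ ∧ vbar ∉ Sθ ∧ (∀ w ∈ Sθ, ¬ θK.IsUnramifiedAt w) ∧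
        (∀ w : HeightOneSpectrum (𝓞 K), w ∉ Sθ → w ≠ v → w ≠ vbar → θK.IsUnramifiedAt w) ∧
        ‖avatarValueAt r γ₁⁻¹ - 1‖ < 1 ∧ ‖avatarValueAt r γ₂⁻¹ - 1‖ < 1) :
    rank_eq_analyticRank_of_analyticRank_le_one → Deuring_exists_heckeCharacter_of_maximalCM →
    ∀ (d : ℤ), d ≠ 0 → Squarefree d → d % 4 ≠ 1 →
    ∀ (W : WeierstrassCurve ℚ) [W.IsElliptic] [W.IsGloballyMinimal] (C : VariableChange ℚ),
      C • W = cm7.quadraticTwist (d : ℚ) → W.analyticRank = 1 →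
    ∃ (K : Type) (_ : Field K) (_ : NumberField K) (v vbar : HeightOneSpectrum (𝓞 K))
      (ι : PadicAlgCl 2 ≃+* ℂ) (c : K ≃ₐ[ℚ] K) (ψ : HeckeCharacter K)
      (κ₁ κ₂ : ZpExtension K 2) (γ₁ γ₂ : absoluteGaloisGroup K)
      (θ : FramedGaloisRep K (padicCoeffIntegers (∅ : Set (PadicAlgCl 2))) 1)
      (θK ρ : HeckeCharacter K) (r : FramedGaloisRep K (PadicAlgCl 2) 1)
      (Sθ : Finset (HeightOneSpectrum (𝓞 K)))
      (P : W.toAffine.Point) (c₀ : ℕ) (ℓ : ℤ),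
      IsImaginaryQuadratic K ∧ ¬ 2 ∣ NumberField.classNumber K ∧
      ((2 : ℕ) : 𝓞 K) ∈ v.asIdeal ∧ ((2 : ℕ) : 𝓞 K) ∈ vbar.asIdeal ∧ vbar ≠ v ∧
      (∀ (w : InfinitePlace K) (k : 𝓞 K), k ∈ v.asIdeal ↔ ‖ι.symm (w.embedding (k : K))‖ < 1) ∧
      c ≠ 1 ∧
      ψ.HasInfinityType (fun _ ↦ 1) (fun _ ↦ 0) ∧
      (∀ s : ℂ, 3 / 2 < s.re → heckeLFunction ψ s = W.LSeries s) ∧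
      ZpExtension.IsTopGeneratorPair κ₁ κ₂ γ₁ γ₂ ∧ κ₂.IsUnramifiedOutside vbar ∧
      (∀ σ : absoluteGaloisGroup K, θ σ ^ 2 = 1) ∧ KellerYin2024.IsHeckeCharOf ι θ θK ∧ θK * θK = 1 ∧
      IsPAdicAvatarOf ι ρ r ∧ FactorsThroughPair κ₁ κ₂ r ∧ θK⁻¹ * ρ = (HeckeCharacter.galConj c ψ)⁻¹ ∧
      v ∉ Sθ ∧ vbar ∉ Sθ ∧ (∀ w ∈ Sθ, ¬ θK.IsUnramifiedAt w) ∧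
      (∀ w : HeightOneSpectrum (𝓞 K), w ∉ Sθ → w ≠ v → w ≠ vbar → θK.IsUnramifiedAt w) ∧
      (∀ G₂ : PowerSeries (PowerSeries (PadicComplexInt 2)), ∃ val : ℂ_[2],
        IntSeries.HasValueAt₂ G₂ (avatarValueAt r γ₁⁻¹ - 1) (avatarValueAt r γ₂⁻¹ - 1) val) ∧
      ¬ IsOfFinAddOrder P ∧
      (∀ R : W.toAffine.Point, ∃ (k : ℤ) (T : W.toAffine.Point), IsOfFinAddOrder T ∧ R = k • P + T) ∧
      c₀ ≠ 0 ∧ (W.baseChange ℚ_[2]).IsInReductionKernel (c₀ • W.toPadicPoint 2 P) ∧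
      ‖(W.baseChange ℚ_[2]).padicLogPoint (c₀ • W.toPadicPoint 2 P) / (c₀ : ℚ_[2])‖ = (2 : ℝ) ^ (-ℓ) := by
  intro hGZK hDeu d hd0 hsq hd4 W _ _ C hCW hr
  -- (a) the frame field data, verbatim as in `RubinValueTwo.stub_katzFrame_two` (p637259)
  have hdQ : (d : ℚ) ≠ 0 := by exact_mod_cast hd0
  haveI := cm7.isElliptic_quadraticTwist hdQ
  obtain ⟨hWj, hjm, hcm, -, -⟩ := FramePinning.cm_data_of_smul_eq_cm7Twist W hd0 hCW
  obtain ⟨K, _, _, h2, hdK⟩ :=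
    Literature.NumberTheory.QuadraticFields.Quadratic.exists_numberField_discr_eq (D := -7)
      (Or.inl ⟨by norm_num, by
        rw [← Int.squarefree_natAbs]
        exact (Nat.prime_iff.mp (by norm_num : Nat.Prime 7)).squarefree, by norm_num⟩)
  have hK : IsImaginaryQuadratic K :=
    isImaginaryQuadratic_iff_discr_neg.mpr ⟨h2, by rw [hdK]; norm_num⟩
  have hKj : IsCMFieldOfJ K W.j := by
    obtain ⟨-, -, θ, -, hθ⟩ :=
      Literature.NumberTheory.QuadraticFields.Quadratic.exists_sq_eq_discr (K := K) h2
    refine ⟨h2, (θ : K), ?_⟩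
    have h := congrArg (algebraMap (𝓞 K) K) hθ
    rw [hdK, map_pow, map_intCast] at h
    rw [hcm]
    exact h
  have hs : Summit.BirchSwinnertonDyer.Rank1Residual.X11b.SplitsIn K 2 := by
    unfold Summit.BirchSwinnertonDyer.Rank1Residual.X11b.SplitsIn
    rw [Nat.cast_ofNat, Literature.NumberTheory.QuadraticFields.Quadratic.ncard_primesOver_two_eq_two_iff h2, hdK]
    decide
  obtain ⟨v, hv⟩ :=
    Literature.NumberTheory.Automorphic.PatchingFamily.exists_heightOneSpectrum_natCast_mem K Nat.prime_two
  obtain ⟨c, vbar, hcv, hne, hvbar, -⟩ :=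
    Summit.BirchSwinnertonDyer.Rank1Residual.X11b.LocalIndexTransport.exists_conj_prime_of_splitsIn K 2 h2 hs hv
  have hc : c ≠ 1 := by
    rintro rfl
    rw [one_smul] at hcv
    exact hne hcv.symm
  obtain ⟨ι₀⟩ := PadicAlgCl.nonempty_ringEquiv_complex 2
  obtain ⟨ι, -, hι⟩ := Summit.BirchSwinnertonDyer.Rank1Residual.X11b.exists_datum_forall_mem_iff 2 ι₀ hK hv
  obtain ⟨ψ, hψinf, hψconj, -, -, hψL⟩ := hDeu W hjm K hKj c hc
  -- (b) `2 ∤ h_K` at the frame field (-w6)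
  have h2K : ¬ 2 ∣ NumberField.classNumber K :=
    FramePinning.not_two_dvd_classNumber_of_frame hd0 hCW hK hv hvbar hne hψL
  -- (c′) an ADAPTED generator pair at `2`: `κ₂` := THE line unramified outside `v̄` (CFT, -w6 g3), completed to a pair (-w4 g7, B12)
  obtain ⟨κ₂, hκ₂⟩ := ZpExtension.existsUnique_isUnramifiedOutside_of_split.exists_isUnramifiedOutside_bar
    ZpExtension.existsUnique_isUnramifiedOutside_of_split_holds hK hv hvbar hne
  obtain ⟨γ₂, hγ₂⟩ := κ₂.exists_isTopGenerator
  obtain ⟨κ₁, γ₁, hpair'⟩ := GeneratorPairSupply.exists_isTopGeneratorPair_of_isTopGenerator_two hK hγ₂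
  have hpair : ZpExtension.IsTopGeneratorPair κ₁ κ₂ γ₁ γ₂ := ⟨hpair'.2.2.2, hpair'.2.2.1, hpair'.2.1, hpair'.1⟩
  -- (d)(e) the quadratic-part socket
  obtain ⟨θ, θK, ρ, r, Sθ, hθ2, hθθK, hθK, hρr, hrpair, hρ, hvS, hvbarS, hSram, hSunr, hn₁, hn₂⟩ :=
    hQ d hd0 W C hCW K hK v vbar hv hvbar hne ι hι c hc ψ hψinf hψconj hψL κ₁ κ₂ γ₁ γ₂ hpair
  -- (f) values exist on the open bidisc (B14)
  have hval : ∀ G₂ : PowerSeries (PowerSeries (PadicComplexInt 2)), ∃ val : ℂ_[2],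
      IntSeries.HasValueAt₂ G₂ (avatarValueAt r γ₁⁻¹ - 1) (avatarValueAt r γ₂⁻¹ - 1) val :=
    fun G₂ ↦ KatzMeasureValue.exists_hasValueAt₂_of_norm_lt_one G₂ hn₁ hn₂
  -- the Mordell–Weil generator (rank one from GZK) and the formal-group clause, as in p637259
  have hrank : W.mordellWeilRank = 1 := by rw [(hGZK W hr.le).1, hr]
  obtain ⟨P, hP, hgen⟩ := exists_generator_of_mordellWeilRank_eq_one W hrank
  have hP' : ¬ IsOfFinAddOrder P := by convert hP
  have hgen' : ∀ R : W.toAffine.Point, ∃ (k : ℤ) (T : W.toAffine.Point), IsOfFinAddOrder T ∧ R = k • P + T := by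
    intro R
    obtain ⟨a, t, ht, hR⟩ := hgen R
    exact ⟨a, t, by convert ht, by convert hR⟩
  obtain ⟨c₀, ℓ, hc₀, hker, hnorm⟩ := RubinValueTwo.exists_index_padicLog_two W hP'
  exact ⟨K, inferInstance, inferInstance, v, vbar, ι, c, ψ, κ₁, κ₂, γ₁, γ₂, θ, θK, ρ, r, Sθ, P, c₀, ℓ, hK, h2K, hv, hvbar, hne,
    hι, hc, hψinf, hψL, hpair, hκ₂, hθ2, hθθK, hθK, hρr, hrpair, hρ, hvS, hvbarS, hSram, hSunr, hval, hP', hgen', hc₀, hker, hnorm⟩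

/-- **S1-v10b — the adapted frame supply WITH `Finite W.sha`** (skeleton v10.5, LEAD g13): `frameSupply_two_v10a_of_quadraticPart` plus the
conjunct `Finite W.sha`, free from the Gross–Zagier–Kolyvagin antecedent `rank_eq_analyticRank_of_analyticRank_le_one` (its second clause) at
analytic rank one. WHY: S3b′ must PRODUCE `D.HasCharValuationAt n` (constant term `H(0) ≠ 0`), i.e. the finiteness of Agboola's
`𝔖_{v̄}(K, W*)` — Agboola §6 (Thm. 6.12) derives `ord_{s=1} L*_𝔭 = r − 1 = 0` only «if Ш(K)(𝔭*) is finite»; without this clause the stub hid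
Rubin's non-vanishing / Kolyvagin's finiteness inside an algebraic statement. [cite: Agboola2007, §6 Thm. 6.12] [cite: GrossZagier1986, Thm. I.(7.3)]
[cite: Washington1997, §13.1 and Thm. 13.4] -/
theorem frameSupply_two_v10b_of_quadraticPart
    (hQ : ∀ (d : ℤ), d ≠ 0 → ∀ (W : WeierstrassCurve ℚ) [W.IsElliptic] [W.IsGloballyMinimal] (C : VariableChange ℚ),
      C • W = cm7.quadraticTwist (d : ℚ) →
      ∀ (K : Type) [Field K] [NumberField K], IsImaginaryQuadratic K →
      ∀ (v vbar : HeightOneSpectrum (𝓞 K)),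
        ((2 : ℕ) : 𝓞 K) ∈ v.asIdeal → ((2 : ℕ) : 𝓞 K) ∈ vbar.asIdeal → vbar ≠ v →
      ∀ (ι : PadicAlgCl 2 ≃+* ℂ),
        (∀ (w : InfinitePlace K) (k : 𝓞 K), k ∈ v.asIdeal ↔ ‖ι.symm (w.embedding (k : K))‖ < 1) →
      ∀ (c : K ≃ₐ[ℚ] K), c ≠ 1 →
      ∀ (ψ : HeckeCharacter K), ψ.HasInfinityType (fun _ ↦ 1) (fun _ ↦ 0) → IsHeckeConjEquivariant c ψ →
        (∀ s : ℂ, 3 / 2 < s.re → heckeLFunction ψ s = W.LSeries s) →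
      ∀ (κ₁ κ₂ : ZpExtension K 2) (γ₁ γ₂ : absoluteGaloisGroup K), ZpExtension.IsTopGeneratorPair κ₁ κ₂ γ₁ γ₂ →
      ∃ (θ : FramedGaloisRep K (padicCoeffIntegers (∅ : Set (PadicAlgCl 2))) 1)
        (θK ρ : HeckeCharacter K) (r : FramedGaloisRep K (PadicAlgCl 2) 1) (Sθ : Finset (HeightOneSpectrum (𝓞 K))),
        (∀ σ : absoluteGaloisGroup K, θ σ ^ 2 = 1) ∧ KellerYin2024.IsHeckeCharOf ι θ θK ∧ θK * θK = 1 ∧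
        IsPAdicAvatarOf ι ρ r ∧ FactorsThroughPair κ₁ κ₂ r ∧ θK⁻¹ * ρ = (HeckeCharacter.galConj c ψ)⁻¹ ∧
        v ∉ Sθ ∧ vbar ∉ Sθ ∧ (∀ w ∈ Sθ, ¬ θK.IsUnramifiedAt w) ∧
        (∀ w : HeightOneSpectrum (𝓞 K), w ∉ Sθ → w ≠ v → w ≠ vbar → θK.IsUnramifiedAt w) ∧
        ‖avatarValueAt r γ₁⁻¹ - 1‖ < 1 ∧ ‖avatarValueAt r γ₂⁻¹ - 1‖ < 1) :
    rank_eq_analyticRank_of_analyticRank_le_one → Deuring_exists_heckeCharacter_of_maximalCM →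
    ∀ (d : ℤ), d ≠ 0 → Squarefree d → d % 4 ≠ 1 →
    ∀ (W : WeierstrassCurve ℚ) [W.IsElliptic] [W.IsGloballyMinimal] (C : VariableChange ℚ),
      C • W = cm7.quadraticTwist (d : ℚ) → W.analyticRank = 1 →
    ∃ (K : Type) (_ : Field K) (_ : NumberField K) (v vbar : HeightOneSpectrum (𝓞 K))
      (ι : PadicAlgCl 2 ≃+* ℂ) (c : K ≃ₐ[ℚ] K) (ψ : HeckeCharacter K)
      (κ₁ κ₂ : ZpExtension K 2) (γ₁ γ₂ : absoluteGaloisGroup K)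
      (θ : FramedGaloisRep K (padicCoeffIntegers (∅ : Set (PadicAlgCl 2))) 1)
      (θK ρ : HeckeCharacter K) (r : FramedGaloisRep K (PadicAlgCl 2) 1)
      (Sθ : Finset (HeightOneSpectrum (𝓞 K)))
      (P : W.toAffine.Point) (c₀ : ℕ) (ℓ : ℤ),
      IsImaginaryQuadratic K ∧ ¬ 2 ∣ NumberField.classNumber K ∧
      ((2 : ℕ) : 𝓞 K) ∈ v.asIdeal ∧ ((2 : ℕ) : 𝓞 K) ∈ vbar.asIdeal ∧ vbar ≠ v ∧
      (∀ (w : InfinitePlace K) (k : 𝓞 K), k ∈ v.asIdeal ↔ ‖ι.symm (w.embedding (k : K))‖ < 1) ∧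
      c ≠ 1 ∧
      ψ.HasInfinityType (fun _ ↦ 1) (fun _ ↦ 0) ∧
      (∀ s : ℂ, 3 / 2 < s.re → heckeLFunction ψ s = W.LSeries s) ∧
      ZpExtension.IsTopGeneratorPair κ₁ κ₂ γ₁ γ₂ ∧ κ₂.IsUnramifiedOutside vbar ∧
      (∀ σ : absoluteGaloisGroup K, θ σ ^ 2 = 1) ∧ KellerYin2024.IsHeckeCharOf ι θ θK ∧ θK * θK = 1 ∧
      IsPAdicAvatarOf ι ρ r ∧ FactorsThroughPair κ₁ κ₂ r ∧ θK⁻¹ * ρ = (HeckeCharacter.galConj c ψ)⁻¹ ∧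
      v ∉ Sθ ∧ vbar ∉ Sθ ∧ (∀ w ∈ Sθ, ¬ θK.IsUnramifiedAt w) ∧
      (∀ w : HeightOneSpectrum (𝓞 K), w ∉ Sθ → w ≠ v → w ≠ vbar → θK.IsUnramifiedAt w) ∧
      (∀ G₂ : PowerSeries (PowerSeries (PadicComplexInt 2)), ∃ val : ℂ_[2],
        IntSeries.HasValueAt₂ G₂ (avatarValueAt r γ₁⁻¹ - 1) (avatarValueAt r γ₂⁻¹ - 1) val) ∧
      ¬ IsOfFinAddOrder P ∧
      (∀ R : W.toAffine.Point, ∃ (k : ℤ) (T : W.toAffine.Point), IsOfFinAddOrder T ∧ R = k • P + T) ∧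
      c₀ ≠ 0 ∧ (W.baseChange ℚ_[2]).IsInReductionKernel (c₀ • W.toPadicPoint 2 P) ∧
      ‖(W.baseChange ℚ_[2]).padicLogPoint (c₀ • W.toPadicPoint 2 P) / (c₀ : ℚ_[2])‖ = (2 : ℝ) ^ (-ℓ) ∧
      Finite W.sha := by
  intro hGZK hDeu d hd0 hsq hd4 W _ _ C hCW hr
  -- (a) the frame field data, verbatim as in `RubinValueTwo.stub_katzFrame_two` (p637259)
  have hdQ : (d : ℚ) ≠ 0 := by exact_mod_cast hd0
  haveI := cm7.isElliptic_quadraticTwist hdQ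
  obtain ⟨hWj, hjm, hcm, -, -⟩ := FramePinning.cm_data_of_smul_eq_cm7Twist W hd0 hCW
  obtain ⟨K, _, _, h2, hdK⟩ :=
    Literature.NumberTheory.QuadraticFields.Quadratic.exists_numberField_discr_eq (D := -7)
      (Or.inl ⟨by norm_num, by
        rw [← Int.squarefree_natAbs]
        exact (Nat.prime_iff.mp (by norm_num : Nat.Prime 7)).squarefree, by norm_num⟩)
  have hK : IsImaginaryQuadratic K :=
    isImaginaryQuadratic_iff_discr_neg.mpr ⟨h2, by rw [hdK]; norm_num⟩
  have hKj : IsCMFieldOfJ K W.j := by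
    obtain ⟨-, -, θ, -, hθ⟩ :=
      Literature.NumberTheory.QuadraticFields.Quadratic.exists_sq_eq_discr (K := K) h2
    refine ⟨h2, (θ : K), ?_⟩
    have h := congrArg (algebraMap (𝓞 K) K) hθ
    rw [hdK, map_pow, map_intCast] at h
    rw [hcm]
    exact h
  have hs : Summit.BirchSwinnertonDyer.Rank1Residual.X11b.SplitsIn K 2 := by
    unfold Summit.BirchSwinnertonDyer.Rank1Residual.X11b.SplitsIn
    rw [Nat.cast_ofNat, Literature.NumberTheory.QuadraticFields.Quadratic.ncard_primesOver_two_eq_two_iff h2, hdK]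
    decide
  obtain ⟨v, hv⟩ :=
    Literature.NumberTheory.Automorphic.PatchingFamily.exists_heightOneSpectrum_natCast_mem K Nat.prime_two
  obtain ⟨c, vbar, hcv, hne, hvbar, -⟩ :=
    Summit.BirchSwinnertonDyer.Rank1Residual.X11b.LocalIndexTransport.exists_conj_prime_of_splitsIn K 2 h2 hs hv
  have hc : c ≠ 1 := by
    rintro rfl
    rw [one_smul] at hcv
    exact hne hcv.symm
  obtain ⟨ι₀⟩ := PadicAlgCl.nonempty_ringEquiv_complex 2
  obtain ⟨ι, -, hι⟩ := Summit.BirchSwinnertonDyer.Rank1Residual.X11b.exists_datum_forall_mem_iff 2 ι₀ hK hv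
  obtain ⟨ψ, hψinf, hψconj, -, -, hψL⟩ := hDeu W hjm K hKj c hc
  -- (b) `2 ∤ h_K` at the frame field (-w6)
  have h2K : ¬ 2 ∣ NumberField.classNumber K :=
    FramePinning.not_two_dvd_classNumber_of_frame hd0 hCW hK hv hvbar hne hψL
  -- (c′) an ADAPTED generator pair at `2`: `κ₂` := THE line unramified outside `v̄` (CFT, -w6 g3), completed to a pair (-w4 g7, B12)
  obtain ⟨κ₂, hκ₂⟩ := ZpExtension.existsUnique_isUnramifiedOutside_of_split.exists_isUnramifiedOutside_bar
    ZpExtension.existsUnique_isUnramifiedOutside_of_split_holds hK hv hvbar hne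
  obtain ⟨γ₂, hγ₂⟩ := κ₂.exists_isTopGenerator
  obtain ⟨κ₁, γ₁, hpair'⟩ := GeneratorPairSupply.exists_isTopGeneratorPair_of_isTopGenerator_two hK hγ₂
  have hpair : ZpExtension.IsTopGeneratorPair κ₁ κ₂ γ₁ γ₂ := ⟨hpair'.2.2.2, hpair'.2.2.1, hpair'.2.1, hpair'.1⟩
  -- (d)(e) the quadratic-part socket
  obtain ⟨θ, θK, ρ, r, Sθ, hθ2, hθθK, hθK, hρr, hrpair, hρ, hvS, hvbarS, hSram, hSunr, hn₁, hn₂⟩ :=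
    hQ d hd0 W C hCW K hK v vbar hv hvbar hne ι hι c hc ψ hψinf hψconj hψL κ₁ κ₂ γ₁ γ₂ hpair
  -- (f) values exist on the open bidisc (B14)
  have hval : ∀ G₂ : PowerSeries (PowerSeries (PadicComplexInt 2)), ∃ val : ℂ_[2],
      IntSeries.HasValueAt₂ G₂ (avatarValueAt r γ₁⁻¹ - 1) (avatarValueAt r γ₂⁻¹ - 1) val :=
    fun G₂ ↦ KatzMeasureValue.exists_hasValueAt₂_of_norm_lt_one G₂ hn₁ hn₂
  -- the Mordell–Weil generator (rank one from GZK) and the formal-group clause, as in p637259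
  have hrank : W.mordellWeilRank = 1 := by rw [(hGZK W hr.le).1, hr]
  have hsha : Finite W.sha := (hGZK W hr.le).2
  obtain ⟨P, hP, hgen⟩ := exists_generator_of_mordellWeilRank_eq_one W hrank
  have hP' : ¬ IsOfFinAddOrder P := by convert hP
  have hgen' : ∀ R : W.toAffine.Point, ∃ (k : ℤ) (T : W.toAffine.Point), IsOfFinAddOrder T ∧ R = k • P + T := by
    intro R
    obtain ⟨a, t, ht, hR⟩ := hgen R
    exact ⟨a, t, by convert ht, by convert hR⟩
  obtain ⟨c₀, ℓ, hc₀, hker, hnorm⟩ := RubinValueTwo.exists_index_padicLog_two W hP'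
  exact ⟨K, inferInstance, inferInstance, v, vbar, ι, c, ψ, κ₁, κ₂, γ₁, γ₂, θ, θK, ρ, r, Sθ, P, c₀, ℓ, hK, h2K, hv, hvbar, hne,
    hι, hc, hψinf, hψL, hpair, hκ₂, hθ2, hθθK, hθK, hρr, hrpair, hρ, hvS, hvbarS, hSram, hSunr, hval, hP', hgen', hc₀, hker, hnorm,
    hsha⟩


end Summit.BirchSwinnertonDyer.BirchSwinnertonDyer.Theorems.PrintCf2.RubinValueTwoV10

end
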